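import Mathlib
import HarnessLib
import Summits.Langlands.Langlands.Statement
import Summits.Langlands.Langlands.Theorems.IrreducibilityBySelfDualityReciprocityUpToIrreducibilityCorrespondsConj
import Summits.Langlands.Langlands.Theorems.IrreducibilityBySelfDualityIrreducibleOffSectorBaseChange
import Literature.NumberTheory.Automorphic.ReciprocityGLnRestrictionProofs
import Literature.NumberTheory.Automorphic.ReciprocityGLnDescentProofs
import Literature.NumberTheory.Automorphic.TunnellOctahedralGlobal
import Literature.NumberTheory.GaloisRepresentations.SatakeFamilyOfFramedGaloisRep
import Literature.NumberTheory.GaloisRepresentations.FrobeniusDensityTheorem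
import Literature.NumberTheory.GaloisRepresentations.ResidualPairIntegrality

/-!
# Descent of weak automorphy (stub `stub_descentOfAutomorphy` of crux stmt-Langlands-1093):
# the two `(A)`-over-`F`-only steps of one descent layer

Support file for the registered line `pieces` of crux stmt-Langlands-1093
(`Summit.Langlands.Langlands.Theses.BaseFieldAscent.ReciprocityTRCM`), stub
`stub_descentOfAutomorphy` (VERBATIM item stmt-Langlands-1062 `LiftDescend.DescentOfAutomorphy`).
The stub itself is an open problem at insoluble Galois layers and is NOT proved here.  This file
proves the two formal steps of the printed argument for ONE Galois layer `F'/F` (Arthur–Clozel,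
Ch. 3, Thm. 4.2 (d); Barnet-Lamb–Gee–Geraghty–Taylor, §5) that use nothing beyond direction (A)
over the BASE `F` — the point queried by the line: no (A) over `F'`, no `Gal(F'/F)`-action on
automorphic forms, no strong multiplicity one is needed for them.

* `isGaloisStableSatakeAE_of_satakeFrobCompatibleAt_restrictField` — **automorphic
  `Gal(F'/F)`-invariance from the Galois side.**  If an automorphic `π'` of `GL_n(𝔸_{F'})` is
  Satake–Frobenius compatible (summit predicate `SatakeFrobCompatibleAt`, L-normalisation) at
  almost every place with a RESTRICTED representation `ρ|_{Γ_{F'}}`, `ρ : Γ_F → GL_n(ℚ̄_ℓ)`, then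
  the Satake data of `π'` are `Gal(F'/F)`-stable almost everywhere (`IsGaloisStableSatakeAE F π'`),
  which is exactly the hypothesis of the tree's cyclic-descent fact `cuspidal_descent_cyclic`
  (Arthur–Clozel Thm. 4.2 (d) in the Borel–Jacquet model, with Jacquet–Shalika folded in).  Proof:
  at a good `w ∣ v`, `ρ` is unramified at `v` (`isUnramifiedAt_of_restrictField`) with Frobenius
  polynomial `∏ (X - b)`, so `ρ|_{Γ_{F'}}` has `∏ (X - b^{f})` at EVERY `w' ∣ v`, `f` the common
  residue degree (`hasFrobCharpolyAt_restrictField`, `inertiaDeg_eq_inertiaDegIn`), and the Satake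
  parameters at `w`, `w'` coincide (`arithFrobPolyOfSatake_injective`, uniqueness of Satake
  parameters and of Frobenius polynomials).
* `exists_isWeakBaseChangeLiftAE_of_cuspidal_descent_cyclic` — hence, granted the named fact
  `cuspidal_descent_cyclic` (UNDISCHARGED in the tree), a cuspidal `π'` weakly attached to
  `ρ|_{Γ_{F'}}` over a cyclic prime-degree layer `F'/F` descends to a cuspidal `π₁` on
  `GL_n(𝔸_F)` with `BC(π₁) = π'` almost everywhere (`IsWeakBaseChangeLiftAE`).
* `exists_corresponds_and_isConjugate_restrictField` — **the Chebotarev step with (A) over `F`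
  only**: if `π₁` is cuspidal L-algebraic on `GL_n(𝔸_F)`, `π'` is a weak base change of `π₁` to
  ANY finite `F'/F`, and `π'` is a.e. compatible with `ρ|_{Γ_{F'}}`, irreducible, then the
  representation `ρ₁ = ρ_{π₁,ι}` supplied by (A) over `F` satisfies `ρ₁|_{Γ_{F'}} ≅ ρ|_{Γ_{F'}}`
  (`IsConjugate`): `ρ₁|_{Γ_{F'}}` is a.e. compatible with `π'`
  (`IrreducibleOffSector.eventually_satakeFrobCompatibleAt_restrictField`) and two avatars of one
  `π'`, one irreducible, are conjugate
  (`ReciprocityUpToIrreducibility.isConjugate_of_satakeFrobCompatibleAt`).  What is left of the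
  layer after this step is Clifford theory (`ρ ≅ ρ₁ ⊗ χ`, `χ` a character of `Gal(F'/F)`) and the
  class-field twist `π₁ ⊗ η`; the twist ambiguity is NOT decidable from the a.e. base-change
  relation alone (at an inert place `t ↦ t^{p}` forgets more than a scalar root of unity), which
  is why (A) over the base of each layer is genuinely used.

References: J. Arthur, L. Clozel, *Simple algebras, base change, and the advanced theory of the
trace formula*, Ann. of Math. Stud. 120 (1989), Ch. 3, §1 (1.1), Thm. 4.2 (d); T. Barnet-Lamb,
T. Gee, D. Geraghty, R. Taylor, *Potential automorphy and change of weight*, Ann. of Math. 179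
(2014), §5; M. Harris, R. Taylor, *The geometry and cohomology of some simple Shimura varieties*
(2001), proof of Thm. VII.1.9 (p. 230); P. Deligne, J.-P. Serre, ASENS 7 (1974), Lemme 3.2.
-/

noncomputable section

-- `Summit.Langlands.Langlands.…` (summit = sub-problem name, D-0017 layout) trips `dupNamespace`.
set_option linter.dupNamespace false

open scoped NumberField Polynomial Matrix Classical MatrixGroups
open Filter IsDedekindDomain Field Polynomial
open Literature.NumberTheory.Automorphic Literature.NumberTheory.GaloisRepresentations
open Summit.Langlands

namespace Summit.Langlands.Langlands.Theorems.ReciprocityTRCM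

section GaloisStable

variable {F : Type} [Field F] [NumberField F] {F' : Type} [Field F'] [NumberField F'] [Algebra F F']
  {n : ℕ} {ℓ : ℕ} [Fact ℓ.Prime]

/-- **Compatibility with a restricted representation forces `Gal(F'/F)`-stable Satake data.**
`F'/F` finite Galois, `ρ : Γ_F → GL_n(ℚ̄_ℓ)`, `π'` an automorphic representation of
`GL_n(𝔸_{F'})` which is Satake–Frobenius compatible with `ρ|_{Γ_{F'}}` (summit predicate, via `ι`)
at almost every place `w`.  Then `IsGaloisStableSatakeAE F π'`: at a good `w ∣ v` (all `w' ∣ v`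
good, `v` unramified in `F'`) `ρ` is unramified at `v` with Frobenius polynomial `∏ (X - b)`, so
`ρ|_{Γ_{F'}}` has `∏ (X - b^{f})` at every `w' ∣ v` with the common residue degree `f`, and the
Satake parameters of `π'` at `w`, `w'` coincide.  This is the unramified shadow of
"`(ρ|_{Γ_{F'}})^σ ≅ ρ|_{Γ_{F'}} ⇒ Π^σ ≅ Π`", obtained WITHOUT strong multiplicity one and without any
`Gal(F'/F)`-action on automorphic forms — the hypothesis of the tree's `cuspidal_descent_cyclic`.
[cite: HarrisTaylorAMS2001, proof of Thm. VII.1.9 (p. 230)] -/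
theorem isGaloisStableSatakeAE_of_satakeFrobCompatibleAt_restrictField [IsGalois F F']
    {hcpt' : isCompact_glFiniteIntegralLevel n F'}
    (ι : PadicAlgCl ℓ ≃+* ℂ) (π' : AutomorphicRepData (AutomorphyDatum.gl n F' hcpt'))
    (ρ : FramedGaloisRep F (PadicAlgCl ℓ) n)
    (h : ∀ᶠ w : HeightOneSpectrum (𝓞 F') in cofinite,
      SatakeFrobCompatibleAt ι π' (ρ.restrictField F') w) :
    IsGaloisStableSatakeAE F π' := by
  have hunr : ∀ᶠ v : HeightOneSpectrum (𝓞 F) in cofinite,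
      Algebra.IsUnramifiedIn (𝓞 F') v.asIdeal := by
    rw [eventually_cofinite]
    exact finite_setOf_not_isUnramifiedIn F F'
  have h1 := eventually_under (E := F') ((eventually_forall_under_eq (F := F) h).and hunr)
  refine h1.mono fun w hw w' hw' α hα => ?_
  obtain ⟨hall, hvE⟩ := hw (w.under (𝓞 F)) rfl
  set v : HeightOneSpectrum (𝓞 F) := w.under (𝓞 F) with hvdef
  have hwv : w.asIdeal.under (𝓞 F) = v.asIdeal := rfl
  -- `ρ` is unramified at `v`
  have hρv : ρ.IsUnramifiedAt v :=
    ρ.isUnramifiedAt_of_restrictField (ramificationIdxIn_eq_one_of_isUnramifiedIn hvE)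
      fun w'' hw'' => by
        obtain ⟨β, -, hur, -⟩ := hall w'' hw''
        exact hur
  -- its Frobenius polynomial at `v`, split into linear factors over `ℚ̄_ℓ`
  obtain ⟨𝔓, h𝔓⟩ := HeightOneSpectrum.primesAbove_nonempty v
  obtain ⟨φ, hφ⟩ := HeightOneSpectrum.exists_isArithFrobAt_of_mem_primesAbove_holds h𝔓
  have hQ : ρ.HasFrobCharpolyAt v (FramedRep.charpoly ρ φ) := hρv.hasFrobCharpolyAt_charpoly h𝔓 hφ
  set Q := FramedRep.charpoly ρ φ with hQdef
  have hsplit : Q = (Q.roots.map fun b => X - C b).prod :=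
    (prod_multiset_X_sub_C_of_monic_of_roots_card_eq (Matrix.charpoly_monic _)
      (IsAlgClosed.card_roots_eq_natDegree)).symm
  have hQ' : ρ.HasFrobCharpolyAt v ((Q.roots.map fun b => X - C b).prod) := hsplit ▸ hQ
  -- the predicted polynomial at every `w'' ∣ v` is `∏ (X - b^f)`, `f = f(v, F'/F)`
  have key : ∀ w'' : HeightOneSpectrum (𝓞 F'), w''.asIdeal.under (𝓞 F) = v.asIdeal →
      ∀ β : Multiset ℂ, π'.HasSatakeParamAt w'' β →
        arithFrobPolyOfSatake ι (v.residueCard ^ v.asIdeal.inertiaDegIn (𝓞 F')) 1 β =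
          (Q.roots.map fun b => X - C (b ^ v.asIdeal.inertiaDegIn (𝓞 F'))).prod := by
    intro w'' hw'' β hβ
    obtain ⟨γ, hγ, -, hc⟩ := hall w'' hw''
    obtain rfl : β = γ := π'.hasSatakeParamAt_unique_holds hβ hγ
    have e2 := ρ.hasFrobCharpolyAt_restrictField hw'' hρv hQ'
    rw [residueCard_eq_residueCard_pow_inertiaDeg hw'', inertiaDeg_eq_inertiaDegIn hw''] at hc
    rw [inertiaDeg_eq_inertiaDegIn hw''] at e2
    exact hc.unique e2
  obtain ⟨αw, hαw, -, -⟩ := hall w hwv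
  obtain ⟨αw', hαw', -, -⟩ := hall w' (hw'.trans hwv)
  have e := (key w hwv αw hαw).trans (key w' (hw'.trans hwv) αw' hαw').symm
  have hq : 0 < v.residueCard ^ v.asIdeal.inertiaDegIn (𝓞 F') :=
    pow_pos (zero_lt_one.trans v.one_lt_residueCard) _
  have heq : αw = αw' := arithFrobPolyOfSatake_injective ι hq 1 e
  obtain rfl : α = αw := π'.hasSatakeParamAt_unique_holds hα hαw
  rw [heq]
  exact hαw'

/-- **Entry ticket to cyclic descent, from the Galois side.**  Granted Arthur–Clozel's cyclic
descent of prime degree in the Borel–Jacquet model (the tree's named fact `cuspidal_descent_cyclic`,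
Ch. 3, Thm. 4.2 (d), taken here as a hypothesis: it is NOT discharged in the tree), a cuspidal `π'`
on `GL_n(𝔸_{F'})`, `F'/F` cyclic of prime degree, which is Satake–Frobenius compatible almost
everywhere with a restricted `ρ|_{Γ_{F'}}`, is the weak base change of a cuspidal `π₁` on
`GL_n(𝔸_F)` (`IsWeakBaseChangeLiftAE`: `t_{π',w} = t_{π₁,v}^{f(w|v)}` a.e.), for every level
witness `hcpt`.  No direction (A), over `F` or `F'`, enters. [cite: ArthurClozelAMS120, Ch. 3 Thm. 4.2 (d)] -/
theorem exists_isWeakBaseChangeLiftAE_of_cuspidal_descent_cyclic [IsGalois F F']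
    (hdesc : cuspidal_descent_cyclic) (hcyc : IsCyclic (F' ≃ₐ[F] F'))
    (hprime : (Module.finrank F F').Prime) (hcpt : isCompact_glFiniteIntegralLevel n F)
    {hcpt' : isCompact_glFiniteIntegralLevel n F'} (ι : PadicAlgCl ℓ ≃+* ℂ)
    (π' : CuspidalAutomorphicRepData n F' hcpt') (ρ : FramedGaloisRep F (PadicAlgCl ℓ) n)
    (h : ∀ᶠ w : HeightOneSpectrum (𝓞 F') in cofinite,
      SatakeFrobCompatibleAt ι π'.1 (ρ.restrictField F') w) :
    ∃ π₁ : CuspidalAutomorphicRepData n F hcpt, IsWeakBaseChangeLiftAE π₁.1 π'.1 :=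
  hdesc n F F' hcpt hcpt' hcyc hprime π'
    (isGaloisStableSatakeAE_of_satakeFrobCompatibleAt_restrictField ι π'.1 ρ h)

end GaloisStable

section Chebotarev

variable {F : Type} [Field F] [NumberField F] {F' : Type} [Field F'] [NumberField F'] [Algebra F F']
  {n : ℕ} {ℓ : ℕ} [Fact ℓ.Prime]

/-- **The Chebotarev step of one descent layer, with (A) over the base `F` only.**  Let `R` be
reciprocity data over `F` carrying direction (A) in rank `n` (`AutomorphicToGalois n R hcpt`),
`π₁` cuspidal L-algebraic on `GL_n(𝔸_F)`, `π'` an automorphic representation of `GL_n(𝔸_{F'})`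
(`F'/F` ANY finite extension) which is a weak base change of `π₁` (`IsWeakBaseChangeLiftAE`), and
`ρ : Γ_F → GL_n(ℚ̄_ℓ)` with `ρ|_{Γ_{F'}}` irreducible and Satake–Frobenius compatible with `π'`
almost everywhere.  Then (A) over `F` supplies an irreducible `R`-geometric `ρ₁` corresponding to
`π₁` at every place, and `ρ|_{Γ_{F'}} ≅ ρ₁|_{Γ_{F'}}` (`IsConjugate`): `ρ₁|_{Γ_{F'}}` is a.e.
compatible with `π'` (restriction along the base-change relation), and two avatars of `π'`, one
irreducible, are conjugate (Chebotarev + Brauer–Nesbitt).  Hence `ρ ≅ ρ₁ ⊗ χ` for a character `χ`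
of `Gal(F'/F)` by Clifford theory — the remaining, (A)-free, part of the layer.
[cite: BarnetlambEtAl2014, §5] [cite: DeligneSerreASENS1974, Lemme 3.2] -/
theorem exists_corresponds_and_isConjugate_restrictField (R : ReciprocityData F)
    {hcpt : isCompact_glFiniteIntegralLevel n F} (hA : AutomorphicToGalois n R hcpt)
    (π₁ : CuspidalAutomorphicRepData n F hcpt) (hL : π₁.1.IsLAlgebraic)
    {hcpt' : isCompact_glFiniteIntegralLevel n F'} (π' : AutomorphicRepData (AutomorphyDatum.gl n F' hcpt'))
    (hBC : IsWeakBaseChangeLiftAE π₁.1 π') (ι : PadicAlgCl ℓ ≃+* ℂ)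
    (ρ : FramedGaloisRep F (PadicAlgCl ℓ) n) (hirr : (ρ.restrictField F').toGaloisRep.IsIrreducible)
    (h : ∀ᶠ w : HeightOneSpectrum (𝓞 F') in cofinite,
      SatakeFrobCompatibleAt ι π' (ρ.restrictField F') w) :
    ∃ ρ₁ : FramedGaloisRep F (PadicAlgCl ℓ) n, ρ₁.toGaloisRep.IsIrreducible ∧
      IsGeometricFramed R ρ₁ ∧ Corresponds R ι π₁.1 ρ₁ ∧
        IsConjugate (ρ.restrictField F') (ρ₁.restrictField F') := by
  obtain ⟨ρ₁, hirr₁, hgeo₁, hcorr₁, -⟩ := hA π₁ hL ℓ ι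
  refine ⟨ρ₁, hirr₁, hgeo₁, hcorr₁, ?_⟩
  exact ReciprocityUpToIrreducibility.isConjugate_of_satakeFrobCompatibleAt π' ι hirr h
    (IrreducibleOffSector.eventually_satakeFrobCompatibleAt_restrictField ι π₁.1 π' hBC ρ₁ hcorr₁.1)

end Chebotarev

/-! ## Registered sub-goal form (crux stmt-Langlands-1093, `--supports`) -/

/-- **Registered sub-goal `stub_isGaloisStableSatakeAE_of_compatible_restrictField` of crux
stmt-Langlands-1093 (verbatim signature)**: the fully quantified form of
`isGaloisStableSatakeAE_of_satakeFrobCompatibleAt_restrictField` — Satake–Frobenius compatibility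
of `π'` with a restricted `ρ|_{Γ_{F'}}` at almost every place of a finite Galois `F'/F` makes the
Satake data of `π'` `Gal(F'/F)`-stable almost everywhere (the hypothesis of cyclic descent,
`cuspidal_descent_cyclic`), as consumed by stubs 3 and 5 of line `pieces`.
[cite: HarrisTaylorAMS2001, proof of Thm. VII.1.9 (p. 230)] -/
theorem stub_isGaloisStableSatakeAE_of_compatible_restrictField : ∀ (F : Type) [Field F] [NumberField F] (F' : Type) [Field F'] [NumberField F'] [Algebra F F'] [IsGalois F F'] (n : ℕ) (hcpt' : Literature.NumberTheory.Automorphic.isCompact_glFiniteIntegralLevel n F') (ℓ : ℕ) [Fact ℓ.Prime] (ι : PadicAlgCl ℓ ≃+* ℂ) (π' : Literature.NumberTheory.Automorphic.AutomorphicRepData (Literature.NumberTheory.Automorphic.AutomorphyDatum.gl n F' hcpt')) (ρ : Literature.NumberTheory.GaloisRepresentations.FramedGaloisRep F (PadicAlgCl ℓ) n), (∀ᶠ w : IsDedekindDomain.HeightOneSpectrum (NumberField.RingOfIntegers F') in Filter.cofinite, SatakeFrobCompatibleAt ι π' (ρ.restrictField F') w) → Literature.NumberTheory.Automorphic.IsGaloisStableSatakeAE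 F π' :=
  fun _F _ _ F' _ _ _ _ _n _hcpt' _ℓ _ ι π' ρ h =>
    isGaloisStableSatakeAE_of_satakeFrobCompatibleAt_restrictField (F' := F') ι π' ρ h

end Summit.Langlands.Langlands.Theorems.ReciprocityTRCM

end
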